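import Summits.BirchSwinnertonDyer.Rank1Residual.Additive.GordBranchPAdicGrossZagierOdd
import Summits.BirchSwinnertonDyer.Rank1Residual.Additive.GordRankOneKatoUpperBound
import Summits.BirchSwinnertonDyer.Rank1Residual.Additive.SemistableTwistTowerThree
import Summits.BirchSwinnertonDyer.Rank1Residual.AdditivePotMult.PotMultBranchPAdicGrossZagierRankOne
import Summits.BirchSwinnertonDyer.Rank1Residual.AdditivePotMult.PotMultRankOneKatoCertificate
import HarnessLib

/-!
# T-O7c (iv): the typed branch `p`-adic Gross–Zagier + Kato's UPPER divisibility (published) give the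
# UPPER HALF of `BSD(E,p)` in analytic rank one — on all three semistable-twist row types ((G-ord) even
# / odd branch, (M)), EVERY admissible `p` (`p = 3` included), with NO non-anomalous hypothesis
# (cell `b2b-bsdres`, team n1011, seat p01 GEN 2, OWNERS row T-O7c; sequel of
# `GordBranchPAdicGrossZagier{,Odd}[Converse].lean`, `PotMultBranchPAdicGrossZagier{,RankOne}.lean`)

HONEST FRAMING (cell `b2b-bsdres`, run/shared/lean/b2b/bsd-rank1-residual/, verbatim in every
file): prove what is provable now; shrink each hard class to its core with data; no claim beyond
stated classes. Research routes; census output = EVIDENCE / conjecture items, never a Literature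
fact; RESIDUAL-MAP marks change only by signed lines. §I O7 stays OPEN; X4♯(G-ord) / X4(M) stay
CONSTRUCTION-SHAPED; nothing is booked; no label changes. COVERAGE (stated first, referee 1
proviso): `E/ℚ` of analytic rank `1`, additive at `p` with a semistable quadratic twist `E♭ = V`
(`C • V^{(p*)} = E`): (G-ord) defect 2 with `V` good ordinary (both parities of `(p−1)/2`) or (M) with
`V` multiplicative (both signs), `ρ̄_{E,p}` SURJECTIVE (tower derived from surj(p), Wuthrich 2014
Lemma 20 proved in the tree — NO `p ≥ 5`), a height datum `Dh` with Delbourgo's (B)-clauses and the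
Schneider rider. NO definition, NO Literature fact minted, NO `_holds`; theorems only. The Kato-type
bound is additive-p2 gen 19's cell-agnostic core `schneider_and_padicVal_le_rankOne_of_iota_eq`
(`GordRankOneKatoUpperBound.lean`, IMPORTED, not restated); the (M) full-series brick is n1011-p07's
`AdditivePotMult.isTorsion_and_exists_iota_eq_of_katoHalf`.

## What and why

additive-p2 gen 19 (`GordRankOneKatoUpperBound.lean`) proved, from Kato's `ι g = C(u·ϖ)·B` and a
SIMPLE analytic zero `[T¹](ϖ·B) ≠ 0`: Schneider + `ord_p #Ш[p^∞] + ord_p Reg_p + ord_p ∏c + ord_p ℓ ≤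
ord_p [T¹](ϖ·B) + 1 + 2·ord_p #T`, and READ OFF THE CENSUS ("with `h = unit·Reg_p(Dh)` … the bound
reads `ord_p #Ш + ord_p ℓ ≤ ord_p #Ш_an`: the UPPER HALF", EVIDENCE). The hypothesis "`h = unit·Reg_p`"
IS n1011-p01's typed input `BranchPAdicGrossZagier{,Odd,Mult}At W p Dh` (`ϖ·[T¹]B·log_p γ = u·q·Reg_p`
with `L'(E,1) = q·Ω_E·Reg_∞`). HERE that reading becomes a kernel implication:

* §1 CORE (cell-agnostic) `exists_shaAn_padicValNat_add_le_rankOne_of_iota_eq_of_pgz`: Kato's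
  identity for `(g, u, ϖ, B)` ∧ the `p`-adic Gross–Zagier identity for the SAME `(ϖ, B)` ∧ (B)-clauses
  ∧ rider ∧ `rank = r_an = 1` ∧ modularity ⟹ `#Ш_an = s ∈ ℚ` with
  `ord_p #Ш(E) + ord_p ℓ ≤ ord_p s` (`ℓ ∣ p²` Delbourgo's factor) — in particular
  `Typed.MissingUpperBoundAt W p` WITHOUT `ReductionNonAnomalous` (the factor `ℓ` only helps).
  Arithmetic: `ord[T¹](ϖB) + 1 = ord q + ord Reg_p` (from the typed identity, `ord log_p γ = 1`),
  substituted into additive-p2's bound, `Reg_p` cancels, `#Ш_an = q·#T²/∏c`.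
* §2 class forms: `ClassX4Gord.missingUpperBoundAt_rankOne_of_katoHalf_of_schneider_of_
  branchPAdicGrossZagier` (defect 2, `p ≡ 1 (mod 4)` — the RIDER variant of additive-p2 gen 19's
  `ClassX4Gord.missingUpperBoundAt_rankOne_of_katoHalf_of_branchPAdicGrossZagier`, which landed first
  in `GordRankOneKatoBranchGrossZagier.lean` with the weak certificate `BranchCoeffOneNeZeroAt` as
  hypothesis; NOT restated), `ClassX4Gord.…_of_branchPAdicGrossZagierOdd` (odd branch, `p = 3`
  INCLUDED — new), `PotMult.`/`ClassX4M.missingUpperBoundAt_rankOne_of_katoHalf_of_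
  branchPAdicGrossZagierMult` ((M), every odd `p` — new).
So, per (B)-datum: [typed `p`-adic GZ ∧ our LOWER] ⟹ lower half (gen 1); [typed `p`-adic GZ ∧ Kato
UPPER (published)] ⟹ upper half (this file); the `BSDp ↔ typed p-adic GZ` iffs are the sequel
`BranchPAdicGrossZagierIff.lean`.

References: [Kato2004Asterisque] Thm. 17.4 (3); [Wuthrich2014] §3, Cor. 19, Lemma 20; [Delbourgo2002]
Thm. (B); [SteinWuthrich2013] §4 (shape of the Kato-type bound); [MazurTateTeitelbaum1986Invent]
§I.13–I.14; [Miller2011LMS] Def. 1.1; [GreenbergLNM1716] §5.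
-/

noncomputable section

open scoped Classical MatrixGroups ModularForm NumberField

open CongruenceSubgroup WeierstrassCurve NumberField Literature.NumberTheory.EllipticCurves
  Literature.NumberTheory.EllipticCurves.ModularForms
  Literature.NumberTheory.EllipticCurves.Rank1Residual
  Literature.NumberTheory.EllipticCurves.Rank1Residual.Typed
  Literature.NumberTheory.EllipticCurves.Delbourgo2002
  Literature.NumberTheory.GaloisRepresentations
  IsDedekindDomain

namespace Summit.BirchSwinnertonDyer.Rank1Residual.Additive

variable {W : WeierstrassCurve ℚ} [W.IsElliptic] {p : ℕ} [hp : Fact p.Prime]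

/-! ### §1 Core: Kato's identity + the `p`-adic Gross–Zagier identity for the same `(ϖ, B)` ⟹ upper half -/

/-- **CORE (cell-agnostic, rank one).** Let `p ≠ 2`, `r_an(E) = 1` with GZK (`rank = 1`, `Ш` finite)
and modularity (`L'(E,1) ≠ 0`), `Dh` a (B)-datum with the Schneider rider, `D` a cyclotomic dual
datum with `X` torsion and generator `fE`, `g ∈ char_Λ X` with Kato's `ι g = C(u·ϖ)·B`, AND the
`p`-adic Gross–Zagier identity for the same `(ϖ, B)`: `L'(E,1) = q·Ω_E·Reg_∞`,
`ϖ·[T¹]B·log_p γ = u'·q·Reg_p(E,Dh)`. Then `#Ш_an(E) = s := q·#T²/∏c ∈ ℚ` and, with Delbourgo's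
factor `ℓ ∣ p²` (`= 1` off the anomalous rows), **`ord_p #Ш(E) + ord_p ℓ ≤ ord_p s`** — the UPPER
half of `BSD(E,p)`, sharpened by `ℓ`, with NO non-anomalous hypothesis. (additive-p2's Kato-type bound
with `ord[T¹](ϖB) + 1 = ord q + ord Reg_p` substituted; `Reg_p ≠ 0` cancels.)
[cite: Kato2004Asterisque, Thm. 17.4 (3) (p. 273)] [cite: Delbourgo2002, Theorem (B) (p. 40)]
[cite: SteinWuthrich2013, §4 (shape)] [cite: Miller2011LMS, Def. 1.1] -/
theorem exists_shaAn_padicValNat_add_le_rankOne_of_iota_eq_of_pgz (hp2 : p ≠ 2)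
    (hGZK : rank_eq_analyticRank_of_analyticRank_le_one) (hmod : hasEntireLFunction_rat)
    (hr : W.analyticRank = 1) {Dh : PAdicHeightData W p} (hB : LeadingTermClauses W p Dh)
    (hS : SchneiderConjecture Dh)
    {κ : ZpExtension ℚ p} {γ : Field.absoluteGaloisGroup ℚ}
    (hκ : κ.IsCyclotomic) (hγ : κ.IsTopGenerator γ) (hγ' : IsCyclotomicVariable p γ)
    (D : W.SelmerDualData κ γ) [Module.Finite (IwasawaAlgebra p) D.X] (hX : D.IsTorsion)
    {fE g : IwasawaAlgebra p} (hchar : D.charIdeal = Ideal.span {fE}) (hg : g ∈ D.charIdeal)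
    {u : ℤ_[p]ˣ} {ϖ : ℚ} {B : PowerSeries ℚ_[p]}
    (hι : iwasawaToPowerSeries p g =
      PowerSeries.C (((u : ℤ_[p]) : ℚ_[p]) * (ϖ : ℚ_[p])) * B)
    {u' : ℤ_[p]ˣ} {q : ℚ}
    (hlead : W.leadingLCoeff = (q : ℂ) * (W.realPeriodRat : ℂ) * (W.regulator : ℂ))
    (hpgz : ((ϖ : ℚ) : ℚ_[p]) * PowerSeries.coeff W.mordellWeilRank B *
        padicLog p (cyclotomicGenerator p) ^ W.mordellWeilRank =
      ((u' : ℤ_[p]) : ℚ_[p]) * (q : ℚ_[p]) * padicRegulator Dh) :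
    ∃ (s : ℚ) (ℓ : ℕ), shaAn W = (s : ℂ) ∧ ℓ ∣ p ^ 2 ∧ (ReductionNonAnomalous W p → ℓ = 1) ∧
      (padicValNat p W.shaOrder : ℤ) + padicValNat p ℓ ≤ padicValRat p s := by
  have hpP : p.Prime := hp.out
  obtain ⟨hmw, hfinSha⟩ := hGZK W (by rw [hr])
  have hr1 : W.mordellWeilRank = 1 := by rw [hmw, hr]
  haveI : Finite W.sha := hfinSha
  rw [hr1, pow_one] at hpgz
  -- `q ≠ 0` (modularity: `L'(E,1) ≠ 0`)
  have hL0 : W.leadingLCoeff ≠ 0 := W.leadingLCoeff_ne_zero_holds (hmod W)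
  have hq0 : q ≠ 0 := by
    rintro rfl
    apply hL0
    rw [hlead]
    simp
  have hqQ : ((q : ℚ) : ℚ_[p]) ≠ 0 := by exact_mod_cast hq0
  have hu'0 : ((u' : ℤ_[p]) : ℚ_[p]) ≠ 0 := coe_units_ne_zero p u'
  have hRg0 : padicRegulator Dh ≠ 0 := hS
  obtain ⟨w, hw⟩ := exists_unit_padicLog_cyclotomicGenerator (p := p) hp2
  have hpQ : (p : ℚ_[p]) ≠ 0 := by exact_mod_cast hpP.ne_zero
  have hlog0 : padicLog p (cyclotomicGenerator p : ℚ_[p]) ≠ 0 := by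
    rw [hw]; exact mul_ne_zero hpQ (coe_units_ne_zero p w)
  have hlogv : (padicLog p (cyclotomicGenerator p : ℚ_[p])).valuation = 1 := by
    rw [hw, Padic.valuation_mul hpQ (coe_units_ne_zero p w), Padic.valuation_p,
      valuation_coe_units_eq_zero, add_zero]
  -- the analytic zero is SIMPLE: `[T¹](ϖ·B) ≠ 0` (from the typed identity and the rider)
  have hc1 : PowerSeries.coeff 1 (PowerSeries.C (ϖ : ℚ_[p]) * B) =
      ((ϖ : ℚ) : ℚ_[p]) * PowerSeries.coeff 1 B := by
    rw [PowerSeries.coeff_C_mul]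
  have hprod0 : ((ϖ : ℚ) : ℚ_[p]) * PowerSeries.coeff 1 B ≠ 0 := by
    intro hz
    rw [hz, zero_mul] at hpgz
    exact mul_ne_zero (mul_ne_zero hu'0 hqQ) hRg0 hpgz.symm
  have hne : PowerSeries.coeff 1 (PowerSeries.C (ϖ : ℚ_[p]) * B) ≠ 0 := by rw [hc1]; exact hprod0
  -- additive-p2's Kato-type bound
  obtain ⟨-, -, ℓ, hℓp, hℓ1, hle⟩ := schneider_and_padicVal_le_rankOne_of_iota_eq hp2 hr1 hB hκ hγ hγ'
    D hX hchar hg hι hne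
  rw [hc1, padicValNat_card_addPrimaryComponent] at hle
  -- the valuation of `[T¹](ϖB)` from the typed identity
  have hval := congrArg Padic.valuation hpgz
  rw [Padic.valuation_mul hprod0 hlog0, hlogv, Padic.valuation_mul (mul_ne_zero hu'0 hqQ) hRg0,
    Padic.valuation_mul hu'0 hqQ, valuation_coe_units_eq_zero, zero_add, Padic.valuation_ratCast] at hval
  -- the analytic order of `Ш`
  set s : ℚ := q * (W.torsionOrder : ℚ) ^ 2 / (W.tamagawaProduct : ℚ) with hs_def
  refine ⟨s, ℓ, shaAn_eq_of_leadingLCoeff_eq W hlead, hℓp, hℓ1, ?_⟩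
  have hT0 : W.torsionOrder ≠ 0 := (W.torsionOrder_pos_holds).ne'
  have hTq : (W.torsionOrder : ℚ) ≠ 0 := by exact_mod_cast hT0
  have hPq : (W.tamagawaProduct : ℚ) ≠ 0 := by
    exact_mod_cast (W.tamagawaProduct_pos_holds : 0 < W.tamagawaProduct).ne'
  rw [hs_def, padicValRat.div (mul_ne_zero hq0 (pow_ne_zero 2 hTq)) hPq,
    padicValRat.mul hq0 (pow_ne_zero 2 hTq), padicValRat.pow, padicValRat.of_nat,
    padicValRat.of_nat, WeierstrassCurve.shaOrder]
  push_cast at hle hval ⊢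
  linarith

/-- **CORE ⟹ `Typed.MissingUpperBoundAt W p`** (drop the factor `ℓ`: `ord_p ℓ ≥ 0`) — NO
`ReductionNonAnomalous` hypothesis. [cite: Kato2004Asterisque, Thm. 17.4 (3) (p. 273)]
[cite: Delbourgo2002, Theorem (B) (p. 40)] [cite: Miller2011LMS, Def. 1.1] -/
theorem missingUpperBoundAt_rankOne_of_iota_eq_of_pgz (hp2 : p ≠ 2)
    (hGZK : rank_eq_analyticRank_of_analyticRank_le_one) (hmod : hasEntireLFunction_rat)
    (hr : W.analyticRank = 1) {Dh : PAdicHeightData W p} (hB : LeadingTermClauses W p Dh)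
    (hS : SchneiderConjecture Dh)
    {κ : ZpExtension ℚ p} {γ : Field.absoluteGaloisGroup ℚ}
    (hκ : κ.IsCyclotomic) (hγ : κ.IsTopGenerator γ) (hγ' : IsCyclotomicVariable p γ)
    (D : W.SelmerDualData κ γ) [Module.Finite (IwasawaAlgebra p) D.X] (hX : D.IsTorsion)
    {fE g : IwasawaAlgebra p} (hchar : D.charIdeal = Ideal.span {fE}) (hg : g ∈ D.charIdeal)
    {u : ℤ_[p]ˣ} {ϖ : ℚ} {B : PowerSeries ℚ_[p]}
    (hι : iwasawaToPowerSeries p g =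
      PowerSeries.C (((u : ℤ_[p]) : ℚ_[p]) * (ϖ : ℚ_[p])) * B)
    {u' : ℤ_[p]ˣ} {q : ℚ}
    (hlead : W.leadingLCoeff = (q : ℂ) * (W.realPeriodRat : ℂ) * (W.regulator : ℂ))
    (hpgz : ((ϖ : ℚ) : ℚ_[p]) * PowerSeries.coeff W.mordellWeilRank B *
        padicLog p (cyclotomicGenerator p) ^ W.mordellWeilRank =
      ((u' : ℤ_[p]) : ℚ_[p]) * (q : ℚ_[p]) * padicRegulator Dh) :
    MissingUpperBoundAt W p := by
  obtain ⟨s, ℓ, hs, -, -, hle⟩ := exists_shaAn_padicValNat_add_le_rankOne_of_iota_eq_of_pgz hp2 hGZK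
    hmod hr hB hS hκ hγ hγ' D hX hchar hg hι hlead hpgz
  refine ⟨s, hs, ?_⟩
  have h0 : (0 : ℤ) ≤ padicValNat p ℓ := by exact_mod_cast Nat.zero_le _
  linarith

/-! ### §2 Class forms: defect 2 (both parities) and (M) -/

/-- **X4♯(G-ord) ∩ `I₀*` ∩ {`ρ̄_{E,p}` onto}, `p ≡ 1 (mod 4)` (hence `p ≥ 5`), `r_an = 1`: the typed
EVEN-branch `p`-adic Gross–Zagier for ONE (B)-datum with the rider + Kato's half (published) ⟹ the
UPPER half `Typed.MissingUpperBoundAt W p`** — NO non-anomalous / CM hypothesis. This is the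
RIDER VARIANT of additive-p2 gen 19's `ClassX4Gord.missingUpperBoundAt_rankOne_of_katoHalf_of_
branchPAdicGrossZagier` (`GordRankOneKatoBranchGrossZagier.lean`, landed first: hypothesis = the weak
certificate `BranchCoeffOneNeZeroAt W p`; here = Schneider's `Reg_p(Dh) ≠ 0`, the binder shape of all
T-O7 class forms — under the typed identity the two are interchangeable, `[T¹](ϖB) ≠ 0 ↔ Reg_p ≠ 0`).
The twist datum `(V, C, f, ϖ⁺)` is DISCHARGED (`ClassX4Gord.exists_goodOrd_pStar_twist_model`, `hmodD`),
the tower of `V` from surj(p) (Lemma 20, good ordinary case). [cite: Kato2004Asterisque, Thm. 17.4 (3) (p. 273)]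
[cite: Wuthrich2014, Lemma 20 (p. 399)] [cite: Delbourgo2002, Theorem (B) (p. 40)] [cite: Miller2011LMS, Def. 1.1] -/
theorem ClassX4Gord.missingUpperBoundAt_rankOne_of_katoHalf_of_schneider_of_branchPAdicGrossZagier
    [W.IsGloballyMinimal]
    (hK : Wuthrich2014.kato_halfEigenCharIdeal_dvd_cyclotomicPrime_of_surjective)
    (hGZK : rank_eq_analyticRank_of_analyticRank_le_one) (hmod : hasEntireLFunction_rat)
    (hmodD : nonempty_modularParametrizationData) (hX : ClassX4Gord W p)
    (he : semistabilityIndex W p = 2) (hp4 : p % 4 = 1) (hsurj : Surj W p) (hr : W.analyticRank = 1)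
    {Dh : PAdicHeightData W p} (hB : LeadingTermClauses W p Dh) (hS : SchneiderConjecture Dh)
    (hGZ : BranchPAdicGrossZagierAt W p Dh) : MissingUpperBoundAt W p := by
  have hp2 : p ≠ 2 := hX.addv.1
  have heven : Even (p / 2) := ⟨p / 4, by omega⟩
  obtain ⟨V, iV, iVm, C, hV, hC⟩ := hX.exists_goodOrd_pStar_twist_model W p he
  haveI : NeZero (V.conductorNorm ℤ) := ⟨(V.conductorNorm_pos_holds).ne'⟩
  obtain ⟨Dm⟩ := hmodD V
  obtain ⟨ϖ, -, hϖ, -⟩ := Dm.exists_rat_mul_realPeriodRat_eq_plusPeriod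
  have hps : ((-1 : ℚ) ^ (p / 2) * (p : ℚ)) = (p : ℚ) := by rw [heven.neg_one_pow, one_mul]
  have hVW : ∃ C : VariableChange ℚ, C • V.quadraticTwist (p : ℚ) = W := ⟨C, by rw [← hps]; exact hC⟩
  obtain ⟨κ, γ, hκ, hγ, hγ', D, fE, hchar⟩ := exists_cyclotomic_dualData_generator W p
  haveI : Module.Finite (IwasawaAlgebra p) D.X :=
    SelmerDualData.module_finite_of_isCyclotomic (W := W) (κ := κ) hκ D hγ
  have hj := padicValRat_j_nonneg_of_typeGOrd W p hX.typeGOrd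
  have hsV : Surj V p := (surj_iff_of_model_twist V p (pStar_ne_zero p) ⟨C, hC⟩).mp hsurj
  have hsurjV : ∀ n : ℕ, V.HasSurjectiveModNGaloisRep (p ^ n : ℕ) :=
    V.forall_hasSurjectiveModNGaloisRep_pow_of_goodOrdinary_of_surj p hp2 hV.1 hV.2 hsV
  have hϖ' : (if Even (p / 2) then (ϖ : ℝ) * V.realPeriodRat = plusPeriod Dm.f
      else (ϖ : ℝ) * V.imaginaryPeriodRat = minusPeriod Dm.f) := by
    rw [if_pos heven]; exact hϖ
  obtain ⟨hXt, g, hg, u, hι⟩ := isTorsion_and_exists_iota_eq_branch_of_katoComponent W p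
    (Kato2004.charIdeal_dvd_padicLFunctionBranch_component_of_surjective_of_half hK) hj hp2 V
    ⟨C, hC⟩ (Or.inl hV) hsurjV hκ hγ hγ' Dm.isNewformOf D ϖ hϖ'
  rw [if_pos heven] at hι
  obtain ⟨u', q, hlead, hpgz⟩ := hGZ V hp4 hVW hV Dm.isNewformOf ϖ hϖ
  exact missingUpperBoundAt_rankOne_of_iota_eq_of_pgz hp2 hGZK hmod hr hB hS hκ hγ hγ' D hXt hchar hg
    hι hlead hpgz

/-- **X4♯(G-ord) ∩ `I₀*` ∩ {`ρ̄_{E,p}` onto}, `p ≡ 3 (mod 4)` (`p = 3` INCLUDED), `r_an = 1`: the typed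
ODD-branch `p`-adic Gross–Zagier for ONE (B)-datum with the rider + Kato's half ⟹ the UPPER half.**
[cite: Kato2004Asterisque, Thm. 17.4 (3) (p. 273)] [cite: Wuthrich2014, Lemma 20 (p. 399)]
[cite: Delbourgo2002, Theorem (B) (p. 40)] [cite: Miller2011LMS, Def. 1.1] -/
theorem ClassX4Gord.missingUpperBoundAt_rankOne_of_katoHalf_of_branchPAdicGrossZagierOdd
    [W.IsGloballyMinimal]
    (hK : Wuthrich2014.kato_halfEigenCharIdeal_dvd_cyclotomicPrime_of_surjective)
    (hGZK : rank_eq_analyticRank_of_analyticRank_le_one) (hmod : hasEntireLFunction_rat)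
    (hmodD : nonempty_modularParametrizationData) (hX : ClassX4Gord W p)
    (he : semistabilityIndex W p = 2) (hp4 : p % 4 = 3) (hsurj : Surj W p) (hr : W.analyticRank = 1)
    {Dh : PAdicHeightData W p} (hB : LeadingTermClauses W p Dh) (hS : SchneiderConjecture Dh)
    (hGZ : BranchPAdicGrossZagierOddAt W p Dh) : MissingUpperBoundAt W p := by
  have hp2 : p ≠ 2 := hX.addv.1
  have hodd : ¬ Even (p / 2) := by
    rw [Nat.not_even_iff_odd]
    exact ⟨p / 4, by omega⟩
  obtain ⟨V, iV, iVm, C, hV, hC⟩ := hX.exists_goodOrd_pStar_twist_model W p he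
  haveI : NeZero (V.conductorNorm ℤ) := ⟨(V.conductorNorm_pos_holds).ne'⟩
  obtain ⟨Dm⟩ := hmodD V
  obtain ⟨ϖ, -, hϖ⟩ := exists_rat_mul_imaginaryPeriodRat_eq_minusPeriod Dm
  have hps : ((-1 : ℚ) ^ (p / 2) * (p : ℚ)) = -(p : ℚ) := by
    rw [pStar_eq_of_mod_four p (Or.inr hp4), if_neg (by omega)]
  have hVW : ∃ C : VariableChange ℚ, C • V.quadraticTwist (-(p : ℚ)) = W :=
    ⟨C, by rw [← hps]; exact hC⟩
  obtain ⟨κ, γ, hκ, hγ, hγ', D, fE, hchar⟩ := exists_cyclotomic_dualData_generator W p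
  haveI : Module.Finite (IwasawaAlgebra p) D.X :=
    SelmerDualData.module_finite_of_isCyclotomic (W := W) (κ := κ) hκ D hγ
  have hj := padicValRat_j_nonneg_of_typeGOrd W p hX.typeGOrd
  have hsV : Surj V p := (surj_iff_of_model_twist V p (pStar_ne_zero p) ⟨C, hC⟩).mp hsurj
  have hsurjV : ∀ n : ℕ, V.HasSurjectiveModNGaloisRep (p ^ n : ℕ) :=
    V.forall_hasSurjectiveModNGaloisRep_pow_of_goodOrdinary_of_surj p hp2 hV.1 hV.2 hsV
  have hϖ' : (if Even (p / 2) then (ϖ : ℝ) * V.realPeriodRat = plusPeriod Dm.f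
      else (ϖ : ℝ) * V.imaginaryPeriodRat = minusPeriod Dm.f) := by
    rw [if_neg hodd]; exact hϖ
  obtain ⟨hXt, g, hg, u, hι⟩ := isTorsion_and_exists_iota_eq_branch_of_katoComponent W p
    (Kato2004.charIdeal_dvd_padicLFunctionBranch_component_of_surjective_of_half hK) hj hp2 V
    ⟨C, hC⟩ (Or.inl hV) hsurjV hκ hγ hγ' Dm.isNewformOf D ϖ hϖ'
  rw [if_neg hodd] at hι
  obtain ⟨u', q, hlead, hpgz⟩ := hGZ V hp4 hVW hV Dm.isNewformOf ϖ hϖ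
  exact missingUpperBoundAt_rankOne_of_iota_eq_of_pgz hp2 hGZK hmod hr hB hS hκ hγ hγ' D hXt hchar hg
    hι hlead hpgz

end Summit.BirchSwinnertonDyer.Rank1Residual.Additive

namespace Summit.BirchSwinnertonDyer.Rank1Residual.AdditivePotMult

open Additive

variable {W : WeierstrassCurve ℚ} [W.IsElliptic] {p : ℕ} [hp : Fact p.Prime]

/-- **(M) ∩ {`ρ̄_{E,p}` onto}, EVERY odd `p` (`p = 3` included), `r_an = 1`: the typed (M) `p`-adic
Gross–Zagier for ONE (B)-datum with the rider + Kato's half (published, through n1011-p07's full-series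
brick) ⟹ the UPPER half `Typed.MissingUpperBoundAt W p`.** The twist datum `(V = E♭, C, f, B, ϖ)` is
DISCHARGED (`PotMult.exists_mult_pStar_twist_model`, `hmodD`, the branch series of the reduction
sign, the period ratio of the parity); the tower of `E♭` from surj(p) (`PotMult.towerSurj_twist_of_surj`).
[cite: Kato2004Asterisque, Thm. 17.4 (3) (p. 273)] [cite: Wuthrich2014, §3 (p. 390), Lemma 20 (p. 399)]
[cite: Delbourgo2002, Theorem (B) (p. 40)] [cite: Miller2011LMS, Def. 1.1] -/
theorem PotMult.missingUpperBoundAt_rankOne_of_katoHalf_of_branchPAdicGrossZagierMult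
    [W.IsGloballyMinimal]
    (hK : Wuthrich2014.kato_halfEigenCharIdeal_dvd_cyclotomicPrime_of_surjective)
    (hGZK : rank_eq_analyticRank_of_analyticRank_le_one) (hmod : hasEntireLFunction_rat)
    (hmodD : nonempty_modularParametrizationData) (hpm : PotMult W p) (hp2 : p ≠ 2)
    (hsurj : Surj W p) (hr : W.analyticRank = 1)
    {Dh : PAdicHeightData W p} (hB : LeadingTermClauses W p Dh) (hS : SchneiderConjecture Dh)
    (hGZ : BranchPAdicGrossZagierMultAt W p Dh) : MissingUpperBoundAt W p := by
  obtain ⟨V, iV, iVm, C, hV, hC⟩ := hpm.exists_mult_pStar_twist_model hp2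
  haveI : NeZero (V.conductorNorm ℤ) := ⟨(V.conductorNorm_pos_holds).ne'⟩
  obtain ⟨Dm⟩ := hmodD V
  obtain ⟨ϖ, hϖ⟩ := exists_periodRatio_parity (p := p) V Dm
  -- the branch series of the reduction sign
  obtain ⟨B, hVB⟩ : ∃ B : PowerSeries ℚ_[p],
      (V.HasSplitMultiplicativeReductionAtPrime p ∧
          B = if Even (p / 2) then padicLFunctionPlusBranchMult Dm.f (1 : ℚ_[p]) (p / 2)
            else padicLFunctionMinusBranchMult Dm.f (1 : ℚ_[p]) (p / 2)) ∨
        (V.HasMultiplicativeReductionAtPrime p ∧ ¬ V.HasSplitMultiplicativeReductionAtPrime p ∧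
          B = if Even (p / 2) then padicLFunctionPlusBranchMult Dm.f (-1 : ℚ_[p]) (p / 2)
            else padicLFunctionMinusBranchMult Dm.f (-1 : ℚ_[p]) (p / 2)) := by
    by_cases hs : V.HasSplitMultiplicativeReductionAtPrime p
    · exact ⟨_, Or.inl ⟨hs, rfl⟩⟩
    · exact ⟨_, Or.inr ⟨hV, hs, rfl⟩⟩
  obtain ⟨κ, γ, hκ, hγ, hγ', D, fE, hchar⟩ := exists_cyclotomic_dualData_generator W p
  haveI : Module.Finite (IwasawaAlgebra p) D.X :=
    SelmerDualData.module_finite_of_isCyclotomic (W := W) (κ := κ) hκ D hγ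
  have hsurjV : ∀ n : ℕ, V.HasSurjectiveModNGaloisRep (p ^ n : ℕ) :=
    hpm.towerSurj_twist_of_surj hp2 hsurj V C hC
  obtain ⟨hXt, g, hg, u, hι⟩ := isTorsion_and_exists_iota_eq_of_katoHalf hK hp2 V C hC hsurjV hκ hγ hγ'
    Dm.isNewformOf D B (Or.inr hVB) ϖ hϖ
  obtain ⟨u', q, hlead, hpgz⟩ := hGZ V B hp2 ⟨C, hC⟩ hVB Dm.isNewformOf ϖ hϖ
  exact missingUpperBoundAt_rankOne_of_iota_eq_of_pgz hp2 hGZK hmod hr hB hS hκ hγ hγ' D hXt hchar hg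
    hι hlead hpgz

/-- **X4(M) ∩ {`ρ̄_{E,p}` onto}, EVERY odd `p`, `r_an = 1`: the typed (M) `p`-adic Gross–Zagier for
ONE (B)-datum with the rider + Kato's half ⟹ the UPPER half** (`p ≠ 2` is part of `ClassX4`). X4(M)
stays CONSTRUCTION-SHAPED; nothing booked. [cite: Kato2004Asterisque, Thm. 17.4 (3) (p. 273)]
[cite: Delbourgo2002, Theorem (B) (p. 40)] [cite: Miller2011LMS, Def. 1.1] -/
theorem ClassX4M.missingUpperBoundAt_rankOne_of_katoHalf_of_branchPAdicGrossZagierMult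
    [W.IsGloballyMinimal]
    (hK : Wuthrich2014.kato_halfEigenCharIdeal_dvd_cyclotomicPrime_of_surjective)
    (hGZK : rank_eq_analyticRank_of_analyticRank_le_one) (hmod : hasEntireLFunction_rat)
    (hmodD : nonempty_modularParametrizationData) (hX : ClassX4M W p) (hsurj : Surj W p)
    (hr : W.analyticRank = 1)
    {Dh : PAdicHeightData W p} (hB : LeadingTermClauses W p Dh) (hS : SchneiderConjecture Dh)
    (hGZ : BranchPAdicGrossZagierMultAt W p Dh) : MissingUpperBoundAt W p :=
  (ClassX4M.potMult W p hX).missingUpperBoundAt_rankOne_of_katoHalf_of_branchPAdicGrossZagierMult hK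
    hGZK hmod hmodD hX.p_ne_two hsurj hr hB hS hGZ

end Summit.BirchSwinnertonDyer.Rank1Residual.AdditivePotMult

end
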